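import Literature.Topology.FourManifolds.HandleSlabSet
import Literature.Topology.FourManifolds.MorseDiscLemma
import Literature.Topology.FourManifolds.PresentationHandlebodyFive
import HarnessLib

/-!
# Kosinski's handle presentation theorem (VII 2.2), Parts 6–7: the two ends of the slab —
# `W ≅ {F ≤ c - ε}` above the level, `{f ≤ c - ε} ≅ Dᵐ` below it

Topic `Literature/Topology/FourManifolds`; continuation of `HandleSlabLevel.lean` (Parts 2–4) and
`HandleSlabSet.lean` (Part 5a) of the formalisation of Kosinski, *Differential Manifolds* (1993),
VII Prop. 2.2, in the tree's model `HandleAttachingMap.IsMultiAttachment` of handle attachment.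

Part 5 (`HandleSlabAttachment.lean`) identifies the slab `{F ≤ c - ε}` of `D : SlabData n W ι`
with the body `M = {f ≤ c - ε}` plus handles.  This file supplies the two ends of the argument
that turn this into a statement about `W` itself:

* **Top** (`SlabData.nonempty_diffeomorph_slabSet`): if the only critical points of `f` on or
  above the level `c - ε` are the `p i`, then **`W ≅ {F ≤ c - ε}`** — the modified function `F`
  has no critical point with `F ≥ c - ε` (the `p i` have `F = c - 5ε/4`), so the regular interval
  theorem for manifolds with boundary applies (Milnor 1963, Thm. 3.1;
  `nonempty_diffeomorph_sublevel_of_forall_le_mfderiv_ne_zero`); consequently any presentation of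
  the slab as `M` with handles attached is one of `W`
  (`SlabData.isMultiAttachment_of_slabSet`, by transport,
  `HandleAttachingMap.IsMultiAttachment.of_diffeomorph`).
* **Bottom** (`SlabData.nonempty_diffeomorph_bodySet_closedBall`): if `f` has exactly one critical
  point in the body, of index `0`, then **`M ≅ Dᵐ`** (Milnor 1963, Thm. 3.1 with the Lemma of
  Morse; the tree's `IsMorseAdapted.nonempty_diffeomorph_closedBall` applied to Milnor's
  Lemma 2.9 function `f|_M + (1 - (c - ε))`, `SlabData.body_morseData`).

Together: a compact `W` whose adapted Morse function has one critical point of index `0` and,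
above it, one critical level of index `λ`, is `Dᵐ` with `λ`-handles attached (Kosinski VII (2.2)
with VI (6.4); for `m = 4`, `λ = 2` and one handle: a `(1,0,1)`-handlebody is a knot trace).
Everything here is proved; no named facts are introduced.

## References

* A. A. Kosinski, *Differential Manifolds*, Academic Press (1993), VII §2, Prop. 2.2 (PDF
  pp. 100–101); VI §6. [Kosinski1993]
* J. Milnor, *Morse theory* (1963), Thms. 3.1–3.2. [Milnor1963]
* J. Milnor, *Lectures on the h-cobordism theorem* (1965), Lemma 2.9. [MilnorHCobordism1965]
-/

open scoped Manifold ContDiff Topology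
open Set Function Metric Real Filter

noncomputable section

universe u

namespace Literature.Topology.FourManifolds

open HandleShrink HandleSlab

namespace SlabData

variable {n : ℕ} {W : Type u} [TopologicalSpace W] [ChartedSpace (EuclideanHalfSpace (n + 1)) W]
  {ι : Type*} (D : SlabData n W ι)

/-- **The critical points `p i` are not in the body** (`f (p i) = c > c - ε`). [folklore] -/
theorem lt_f_p (i : ι) : D.c - D.ε < D.f (D.p i) := by
  rw [D.apply_p]; linarith [D.ε_pos]

variable [Fintype ι] [IsManifold (𝓡∂ (n + 1)) ∞ W] [T2Space W]

/-! ### §1 Top: `W ≅ {F ≤ c - ε}` -/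

/-- **If the only critical points of `f` on or above the level `c - ε` are the `p i`, then `F`
has no critical point with `F ≥ c - ε`.** [cite: Kosinski1993, VII (2.2.3)] -/
theorem mfderiv_F_ne_zero_of_le
    (htop : ∀ z, IsMCriticalPt (𝓡∂ (n + 1)) D.f z → D.c - D.ε ≤ D.f z → ∃ i, z = D.p i)
    {x : W} (hx : D.c - D.ε ≤ D.F x) : mfderiv (𝓡∂ (n + 1)) 𝓘(ℝ, ℝ) D.F x ≠ 0 := by
  intro h0
  have hcrit : IsMCriticalPt (𝓡∂ (n + 1)) D.F x := h0
  have hcrit' := (D.isMCriticalPt_F_iff x).1 hcrit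
  by_cases h : ∃ i, x = D.p i
  · obtain ⟨i, rfl⟩ := h
    rw [D.F_p i] at hx
    linarith [D.ε_pos]
  · have h' : ∀ i, x ≠ D.p i := fun i hi => h ⟨i, hi⟩
    have hF := D.F_eq_of_isMCriticalPt_of_ne hcrit' h'
    obtain ⟨i, hi⟩ := htop x hcrit' (by rw [← hF]; exact hx)
    exact h' i hi

variable [CompactSpace W]

/-- **Top layer: `W ≅ {F ≤ c - ε}`** when the only critical points of `f` on or above `c - ε` are
the `p i` (regular interval theorem for `F` on the compact manifold with boundary `W`,
dimension `n + 1 ≥ 2`). [cite: Milnor1963, Thm. 3.1] -/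
theorem nonempty_diffeomorph_slabSet (hn : 1 ≤ n)
    (htop : ∀ z, IsMCriticalPt (𝓡∂ (n + 1)) D.f z → D.c - D.ε ≤ D.f z → ∃ i, z = D.p i) :
    Nonempty (W ≃ₘ⟮𝓡∂ (n + 1), 𝓡∂ (n + 1)⟯ ↥D.slabSet) :=
  nonempty_diffeomorph_sublevel_of_forall_le_mfderiv_ne_zero hn D.contMDiff_F
    (fun x hx => (D.isMorseAdapted_F.2.1 x hx).1) (fun x hx => D.isMorseAdapted_F.2.2 x hx)
    D.level_sub_lt_one (fun _ hx => D.mfderiv_F_ne_zero_of_le htop hx)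
    (fun _ hq => D.isInteriorPoint_of_mem_slabSet hq) (fun _ hq => D.not_isMCriticalPt_F_of_eq hq)

/-- **A presentation of the slab as `M` with handles attached is a presentation of `W`**, under
the hypothesis of the top layer. [cite: Kosinski1993, VII (2.2)] -/
theorem isMultiAttachment_of_slabSet (hn : 1 ≤ n)
    (htop : ∀ z, IsMCriticalPt (𝓡∂ (n + 1)) D.f z → D.c - D.ε ≤ D.f z → ∃ i, z = D.p i)
    {κ : Type*} [Finite κ] {h : κ → HandleAttachingMap n D.lam ↥D.bodySet}
    (hP : HandleAttachingMap.IsMultiAttachment h (𝓡∂ (n + 1)) ↥D.slabSet) :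
    HandleAttachingMap.IsMultiAttachment h (𝓡∂ (n + 1)) W := by
  obtain ⟨e⟩ := D.nonempty_diffeomorph_slabSet hn htop
  exact hP.of_diffeomorph e.symm

/-! ### §2 Bottom: `{f ≤ c - ε} ≅ Dᵐ` -/

omit [Fintype ι] in
/-- **Bottom layer: the body `M = {f ≤ c - ε}` is a disc** when `f` has exactly one critical point
`p₀` in it, of index `0` (Milnor 1963, Thm. 3.1 and the Lemma of Morse, applied to
`f|_M + (1 - (c - ε))`). [cite: Milnor1963, Thm. 3.1] -/
theorem nonempty_diffeomorph_bodySet_closedBall (hn : 1 ≤ n) {p₀ : W} (hp₀ : IsMCriticalPt (𝓡∂ (n + 1)) D.f p₀)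
    (hp₀c : D.f p₀ ≤ D.c - D.ε) (h0 : morseIndex (𝓡∂ (n + 1)) D.f p₀ = 0)
    (huniq : ∀ z, IsMCriticalPt (𝓡∂ (n + 1)) D.f z → D.f z ≤ D.c - D.ε → z = p₀) :
    Nonempty (↥D.bodySet ≃ₘ⟮𝓡∂ (n + 1), 𝓡∂ (n + 1)⟯
      (Metric.closedBall (0 : EuclideanSpace ℝ (Fin (n + 1))) 1)) := by
  obtain ⟨hM, hcrit, hidx⟩ := D.body_morseData hn
  have hp : IsMCriticalPt (𝓡∂ (n + 1)) (fun x : ↥D.bodySet => D.f x + (1 - (D.c - D.ε))) ⟨p₀, hp₀c⟩ :=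
    (hcrit ⟨p₀, hp₀c⟩).2 hp₀
  refine hM.nonempty_diffeomorph_closedBall hn hp (fun q hq => ?_) ?_
  · exact Subtype.ext (huniq q.1 ((hcrit q).1 hq) q.2)
  · rw [hidx ⟨p₀, hp₀c⟩ hp₀, h0]

end SlabData

end Literature.Topology.FourManifolds
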